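import Summits.FinalStateConjecture.FinalStateConjecture.Theorems.EIHFluxBalanceInertialRecessionRechartTransfer3

/-!
# Route EIHFluxBalance — `InertialRecession` (E′), re-charting on the given region: the causal
# TRANSFER for the rest-frame clock charts with lagged time (…RechartTransfer3 instantiated)

Helper file for the crux `stmt-FinalStateConjecture-17403`
(`Summit.FinalStateConjecture.FinalStateConjecture.Theses.EIHFluxBalance.InertialRecession`, E′),
line `SketchCleanExcision`, stub `stub_rechartOnRegion` (P2′).

`clock_transfer_r12`: the transfer `exterior_subset_certified_union_causalPast₃` (…RechartTransfer3)
instantiated for `N` rest-frame clock charts `Ψᵢ = Φ ∘ Aᵢ` read on the REST BACKGROUNDS WITH LAGGED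
TIME `⟨boostedKerrExterior 1 0 Mᵢ aᵢ, g_{Mᵢ,aᵢ}, z ↦ z⁰ − s, r_{aᵢ}⟩` (domain the rest exterior, time
`z⁰ − s`, radius `r_{aᵢ}(z)`; the common lag `s ≥ 0` absorbs the additive constant of the slack
dichotomy), from: the exhaustion
clause, eventual lab-time causality, `O` closed under `J⁺ ∩ J⁻(late image)`, the late-region open
embedding; per hole the lab clock `θᵢ → ∞` (`θᵢ t ≤ t + s` eventually), a bounded tilt
`0 ≤ βᵢ ≤ Bᵢ`, a monotone reach profile `Rrᵢ` with the certified Carter reach on `{r ≥ r₊ᵢ + 1}`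
after `Sᵢ` (…StubRechart12Clock), coverage at every stage with the sharp time clause, the inner
dictionary inside the zone radius `r₊ᵢ + 1`; the ball profile `Rb` with its clauses and the flat
profile `R'` with `c R' ≤ Rb` (…StubRechart12Profile), the bound `rpᵢ ≤ c·(lab distance)`, and a
flat domain `U₀ = {τf < x⁰, R'(x⁰) < lab distances}`. Output: a chart time `τ₀'` (above any
prescribed threshold) such that for every `τ₁ ≥ τ₀'` every point of `O` is certified-late after
`τ₁` or in `J⁻` of the certified slab at `τ₁` (lagged model time), with certified radii
`t ↦ Rrᵢ(t + s)`. The dictionary of the transfer is `θᵢ − s`; zone radii `Rzᵢ = r₊ᵢ + 1`, `δ = 1`.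
[O'Neill 1983, Ch. 14, pp. 402–404; folklore causal bookkeeping]
-/

noncomputable section

set_option linter.dupNamespace false

open Set Filter Topology Function TopologicalSpace Literature.Geometry.Lorentzian
open scoped Manifold ContDiff

namespace Summit.FinalStateConjecture.FinalStateConjecture.Theorems

/-- The lagged rest time `z ↦ z⁰ − s` is continuous (registered carrier
`continuous_apply_zero_sub_rechart12` of the crux item). [folklore] -/
theorem continuous_apply_zero_sub_rechart12 : open Literature.Geometry.Lorentzian in ∀ (s : ℝ), Continuous fun z : E4 ↦ z 0 - s :=
  fun _ ↦ (PiLp.continuous_apply 2 _ 0).sub continuous_const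

section Transfer

variable {𝓢 : Spacetime 4} {N : ℕ} (M a : Fin N → ℝ) (hrp0 : ∀ i, 0 < Kerr.rPlus (M i) (a i))
  (ξ : Fin N → ℝ → E3) (rpE : Fin N → E4 → ℝ) (hrpc : ∀ i, Continuous (rpE i))
  (U : Opens E4) (Φ : U → 𝓢.carrier) (O : Set 𝓢.carrier) {τ₀ : ℝ}
  (hexh : ∀ t₁ : ℝ, τ₀ < t₁ →
    O \ Φ '' {x : U | t₁ < x.1 0 ∧ ∀ j, Kerr.rPlus (M j) (a j) < rpE j x.1} ⊆
      𝓢.metric.causalPast 𝓢.timeOrientation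
        (Φ '' {x : U | x.1 0 = t₁ ∧ ∀ j, Kerr.rPlus (M j) (a j) < rpE j x.1}))
  {τT : ℝ}
  (hT : ∀ x x' : U, τT < x.1 0 → (∀ j, Kerr.rPlus (M j) (a j) < rpE j x.1) → τT < x'.1 0 →
    (∀ j, Kerr.rPlus (M j) (a j) < rpE j x'.1) →
    Φ x' ∈ 𝓢.metric.causalFuture 𝓢.timeOrientation {Φ x} → x.1 0 ≤ x'.1 0)
  (hOcl : ∀ p ∈ O, ∀ z : 𝓢.carrier, z ∈ 𝓢.metric.causalFuture 𝓢.timeOrientation {p} →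
    z ∈ 𝓢.metric.causalPast 𝓢.timeOrientation
      (Φ '' {x : U | τ₀ < x.1 0 ∧ ∀ j, Kerr.rPlus (M j) (a j) < rpE j x.1}) → z ∈ O)
  (himO : Φ '' {x : U | τ₀ < x.1 0 ∧ ∀ j, Kerr.rPlus (M j) (a j) < rpE j x.1} ⊆ O)
  (hembΦ : IsOpenEmbedding (({x : U | τ₀ < x.1 0} : Set U).restrict Φ))
  -- the rest charts
  (sL : ℝ) (hsL : 0 ≤ sL) (A : Fin N → E4 → E4)
  (hAU : ∀ i, ∀ y ∈ boostedKerrExterior 1 0 (M i) (a i), A i y ∈ U)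
  (hAlate : ∀ i (y : E4), τ₀ < A i y 0)
  (hψemb : ∀ i, IsOpenEmbedding
    (fun y : boostedKerrExterior 1 0 (M i) (a i) ↦ Φ ⟨A i y.1, hAU i y.1 y.2⟩))
  -- the dictionary
  (θ β Rr : Fin N → ℝ → ℝ) (S : Fin N → ℝ) (tcov : Fin N → ℕ → ℝ) (Tlab Bβ w w' : Fin N → ℝ)
  (hθtop : ∀ i, Tendsto (θ i) atTop atTop) (hθle : ∀ i, ∀ᶠ t in atTop, θ i t ≤ t + sL)
  (hβ0 : ∀ i t, 0 ≤ β i t) (hβB : ∀ i t, β i t ≤ Bβ i) (hRrm : ∀ i, Monotone (Rr i))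
  (hreach : ∀ (i : Fin N) (y : boostedKerrExterior 1 0 (M i) (a i)) (τ₁ : ℝ), S i ≤ y.1 0 →
    y.1 0 ≤ τ₁ → Kerr.rPlus (M i) (a i) + 1 ≤ Kerr.radius (a i) y.1 →
    Kerr.radius (a i) y.1 ≤ Rr i (y.1 0) →
    Φ ⟨A i y.1, hAU i y.1 y.2⟩ ∈ 𝓢.metric.causalPast 𝓢.timeOrientation
      ((fun y : boostedKerrExterior 1 0 (M i) (a i) ↦ Φ ⟨A i y.1, hAU i y.1 y.2⟩) ''
        {z | z.1 0 = τ₁ ∧ Kerr.radius (a i) z.1 ≤ Rr i τ₁}))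
  (hcov : ∀ (i : Fin N) (n : ℕ) (x : E4), tcov i n ≤ x 0 → w i * n + w' i ≤ x 0 / 2 →
    Kerr.rPlus (M i) (a i) < rpE i x → rpE i x ≤ n →
    ∃ y : E4, A i y = x ∧ Kerr.radius (a i) y = rpE i x ∧ |y 0 - θ i (x 0)| ≤ β i (x 0) * rpE i x)
  (hlab : ∀ (i : Fin N) (y : E4), Tlab i ≤ A i y 0 → Kerr.radius (a i) y < Kerr.rPlus (M i) (a i) + 1 →
    rpE i (A i y) = Kerr.radius (a i) y)
  -- the profiles
  (Rb R' : ℝ → ℝ) {Tp c : ℝ} (hc : 0 < c) (hRbt : Tendsto Rb atTop atTop) (hRb0 : ∀ t, 0 ≤ Rb t)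
  (hprof : ∀ t, Tp ≤ t → c * R' t ≤ Rb t ∧ ∀ i, (∃ n : ℕ, Rb t = n ∧ tcov i n ≤ t) ∧
    β i t * Rb t ≤ (t - θ i t) + sL ∧ w i * Rb t + w' i ≤ t / 2 ∧
    (∑ j, |S j|) ≤ θ i t - sL - Bβ i * Rb t ∧ Rb t ≤ Rr i (θ i t - Bβ i * Rb t))
  (hrpd : ∀ (i : Fin N) (x : E4), rpE i x ≤ c * ‖E4.spatial x - ξ i (x 0)‖)
  -- the flat domain
  (U₀ : Opens E4) (hU₀ : U₀ ≤ U) {τf : ℝ}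
  (hU₀eq : (U₀ : Set E4) = {x : E4 | τf < x 0 ∧ ∀ i, R' (x 0) < ‖E4.spatial x - ξ i (x 0)‖})

include hrp0 hrpc hexh hT hOcl himO hembΦ hsL hAlate hψemb hθtop hθle hβ0 hβB hRrm hreach hcov hlab hc
  hRbt hRb0 hprof hrpd hU₀eq in
-- long bookkeeping proof
set_option maxHeartbeats 1600000 in
/-- **The causal transfer for the rest-frame clock charts with lagged time.** See the module
docstring. [folklore] -/
theorem clock_transfer_r12 (Textra : ℝ) :
    ∃ τ₀' : ℝ, Textra ≤ τ₀' ∧ τ₀ < τ₀' ∧ τf < τ₀' ∧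
      ∀ τ₁ : ℝ, τ₀' ≤ τ₁ →
        O ⊆ ((Φ ∘ Opens.inclusion hU₀) '' {x : U₀ | τ₁ < x.1 0} ∪
            ⋃ i, (fun y : boostedKerrExterior 1 0 (M i) (a i) ↦ Φ ⟨A i y.1, hAU i y.1 y.2⟩) ''
              {y | τ₁ < y.1 0 - sL ∧ Kerr.radius (a i) y.1 ≤ Rr i (y.1 0 - sL + sL)}) ∪
          𝓢.metric.causalPast 𝓢.timeOrientation
            ((Φ ∘ Opens.inclusion hU₀) '' {x : U₀ | x.1 0 = τ₁} ∪
              ⋃ i, (fun y : boostedKerrExterior 1 0 (M i) (a i) ↦ Φ ⟨A i y.1, hAU i y.1 y.2⟩) ''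
                {y | y.1 0 - sL = τ₁ ∧ Kerr.radius (a i) y.1 ≤ Rr i (τ₁ + sL)}) := by
  classical
  -- ### notation
  set Kb : Fin N → ModelBackground := fun i ↦
    ⟨boostedKerrExterior 1 0 (M i) (a i), boostedKerrBilin 1 0 (M i) (a i), fun z ↦ z 0 - sL, Kerr.radius (a i)⟩
    with hKb
  set ψ : ∀ i, (Kb i).domain → 𝓢.carrier := fun i y ↦ Φ ⟨A i y.1, hAU i y.1 y.2⟩ with hψ
  set Pext : U → Prop := fun x ↦ ∀ j, Kerr.rPlus (M j) (a j) < rpE j x.1 with hPext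
  set rp : Fin N → U → ℝ := fun j x ↦ rpE j x.1 with hrp
  set Rz : Fin N → ℝ := fun i ↦ Kerr.rPlus (M i) (a i) + 1 with hRz
  set θL : Fin N → ℝ → ℝ := fun i t ↦ θ i t - sL with hθL
  set R : Fin N → ℝ → ℝ := fun i t ↦ Rr i (t + sL) with hR
  set Sm : ℝ := ∑ j, |S j| with hSm
  have hRm : ∀ i, Monotone (R i) := fun i s t h ↦ hRrm i (by linarith)
  have hSi : ∀ i, S i ≤ Sm := fun i ↦ (le_abs_self _).trans
    (Finset.single_le_sum (f := fun j ↦ |S j|) (fun j _ ↦ abs_nonneg _) (Finset.mem_univ i))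
  have hRz0 : ∀ i, 0 ≤ Rz i := fun i ↦ by rw [hRz]; linarith [hrp0 i]
  -- injectivity of the lab chart on the late region
  have hinj : ∀ x x' : U, τ₀ < x.1 0 → τ₀ < x'.1 0 → Φ x = Φ x' → x = x' := by
    intro x x' hx hx' h
    have := hembΦ.injective
      (show ({x : U | τ₀ < x.1 0} : Set U).restrict Φ ⟨x, hx⟩ =
        ({x : U | τ₀ < x.1 0} : Set U).restrict Φ ⟨x', hx'⟩ from h)
    exact congrArg Subtype.val this
  -- ### the chart time `τ₀'`
  have hev : ∀ᶠ t in atTop, (∀ i, Rz i ≤ Rb t) ∧ (∀ i, θ i t ≤ t + sL) ∧ (∀ i, Tlab i ≤ t) ∧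
      Tp ≤ t ∧ τ₀ + 1 ≤ t ∧ τf + 1 ≤ t ∧ τT + 1 ≤ t ∧ Textra ≤ t := by
    refine (eventually_all.2 fun i ↦ hRbt.eventually (eventually_ge_atTop _)).and
      ((eventually_all.2 hθle).and ((eventually_all.2 fun i ↦ eventually_ge_atTop _).and
        ((eventually_ge_atTop _).and ((eventually_ge_atTop _).and ((eventually_ge_atTop _).and
          ((eventually_ge_atTop _).and (eventually_ge_atTop _)))))))
  obtain ⟨τ₀', hτ₀'⟩ := eventually_atTop.1 hev
  obtain ⟨hRz', hθle', hTlab', hTp', hτ₀1, hτf', hτT', hTex'⟩ := hτ₀' τ₀' le_rfl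
  have hτ : τ₀ < τ₀' := by linarith
  have hτT : τT < τ₀' := by linarith
  -- ### the threshold `T₂`
  have hT₂ex : ∀ τ₁ : ℝ, ∃ T : ℝ, τ₁ ≤ T ∧ ∀ t, T ≤ t → ∀ i, τ₁ + Bβ i * Rz i + sL ≤ θ i t := by
    intro τ₁
    have h : ∀ᶠ t in atTop, ∀ i, τ₁ + Bβ i * Rz i + sL ≤ θ i t :=
      eventually_all.2 fun i ↦ (hθtop i).eventually (eventually_ge_atTop _)
    obtain ⟨T, hT'⟩ := eventually_atTop.1 h
    exact ⟨max τ₁ T, le_max_left _ _, fun t ht ↦ hT' t ((le_max_right _ _).trans ht)⟩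
  choose T₂ hT₂τ hT₂θ using hT₂ex
  -- ### the transfer
  refine ⟨τ₀', hTex', hτ, by linarith, fun τ₁ hτ₁ ↦ ?_⟩
  refine exterior_subset_certified_union_causalPast₃ U Φ O Pext rp (fun j ↦ Kerr.rPlus (M j) (a j))
    (fun _ ↦ (1 : ℝ)) Rz Kb ψ R hRm U₀ hU₀ Rb T₂ θL β (τ₀ := τ₀) (τ₀' := τ₀') (τT := τT) (Tc := τ₀')
    (S := Sm) hτ hτT le_rfl hβ0 hexh (fun x x' hx hxP hx' hx'P hJ ↦ hT x x' hx hxP hx' hx'P hJ) hOcl himO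
    hembΦ (fun j ↦ (hrpc j).comp continuous_subtype_val) hψemb
    (fun i ↦ (continuous_apply_zero_sub_rechart12 sL)) (fun i ↦ Kerr.continuous_radius (a i))
    ?_ ?_ (fun x j hx ↦ hx j) (fun i t ht ↦ (hτ₀' t ht).1 i) (fun i ↦ le_rfl) ?_ ?_ ?_ ?_ ?_ τ₁ hτ₁
  · -- hlab: the inner dictionary
    intro i y x hxy hx hyr
    have hx0 : τ₀ < x.1 0 := hτ.trans_le hx
    have hxA : x = ⟨A i y.1, hAU i y.1 y.2⟩ := hinj x _ hx0 (hAlate i y.1) hxy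
    have hx1 : x.1 = A i y.1 := congrArg Subtype.val hxA
    show rpE i x.1 = Kerr.radius (a i) y.1
    rw [hx1]
    refine hlab i y.1 ?_ hyr
    rw [← hx1]
    exact ((hτ₀' _ hx).2.2.1 i)
  · -- hsplit
    intro x hx hxP
    by_cases hxU : x.1 ∈ (U₀ : Set E4)
    · exact Or.inl hxU
    · right
      rw [hU₀eq] at hxU
      simp only [Set.mem_setOf_eq, not_and, not_forall, not_lt] at hxU
      obtain ⟨i, hi⟩ := hxU (by linarith [(hτ₀' _ hx).2.2.2.2.2.1])
      refine ⟨i, ?_⟩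
      have h1 := hrpd i x.1
      have h2 : c * ‖E4.spatial x.1 - ξ i (x.1 0)‖ ≤ c * R' (x.1 0) := mul_le_mul_of_nonneg_left hi hc.le
      have h3 := (hprof (x.1 0) (hτ₀' _ hx).2.2.2.1).1
      show rpE i x.1 ≤ Rb (x.1 0)
      linarith
  · -- hstat: the certified Carter reach
    intro i y τ₂ hτ₂ hyS hyt hyr hyR
    change Sm ≤ y.1 0 - sL at hyS
    change y.1 0 - sL ≤ τ₂ at hyt
    change Kerr.rPlus (M i) (a i) + 1 ≤ Kerr.radius (a i) y.1 at hyr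
    change Kerr.radius (a i) y.1 ≤ Rr i (y.1 0 - sL + sL) at hyR
    rw [sub_add_cancel] at hyR
    have h := hreach i y (τ₂ + sL) (by linarith [hSi i]) (by linarith) hyr hyR
    have hset : (Kb i).truncTimeSlab (R i τ₂) τ₂ =
        {z : (Kb i).domain | z.1 0 = τ₂ + sL ∧ Kerr.radius (a i) z.1 ≤ Rr i (τ₂ + sL)} := by
      ext z
      rw [ModelBackground.mem_truncTimeSlab]
      show z.1 0 - sL = τ₂ ∧ Kerr.radius (a i) z.1 ≤ Rr i (τ₂ + sL) ↔ _
      rw [sub_eq_iff_eq_add]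
      rfl
    show ψ i y ∈ 𝓢.metric.causalPast 𝓢.timeOrientation (ψ i '' (Kb i).truncTimeSlab (R i τ₂) τ₂)
    rw [hset]
    exact h
  · -- hcov: coverage at the stage `Rb (x⁰)`
    intro i x hx hxr hxb
    obtain ⟨-, hall⟩ := hprof (x.1 0) (hτ₀' _ hx).2.2.2.1
    obtain ⟨⟨n, hn, hnc⟩, -, hwin, -, -⟩ := hall i
    rw [hn] at hwin hxb
    obtain ⟨y, hAy, hry, hyt⟩ := hcov i n x.1 hnc hwin hxr hxb
    have hymem : y ∈ (Kb i).domain := by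
      show poincareInv 1 0 y ∈ Kerr.exterior (M i) (a i)
      have hp1 : poincareInv 1 0 y = y := by rw [poincareInv, sub_zero]; rfl
      rw [hp1, Kerr.mem_exterior, hry]
      exact max_lt hxr ((hrp0 i).trans hxr)
    refine ⟨⟨y, hymem⟩, ?_, hry, ?_⟩
    · show Φ ⟨A i y, hAU i y hymem⟩ = Φ x
      congr 1
      exact Subtype.ext hAy
    · show |y 0 - sL - (θ i (x.1 0) - sL)| ≤ β i (x.1 0) * rpE i x.1
      rwa [show y 0 - sL - (θ i (x.1 0) - sL) = y 0 - θ i (x.1 0) by ring]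
  · -- hT₂
    intro i τ₂
    refine ⟨fun t ht ↦ ?_, hT₂τ τ₂⟩
    have h1 := hT₂θ τ₂ t ht i
    have h2 : β i t * Rz i ≤ Bβ i * Rz i := mul_le_mul_of_nonneg_right (hβB i t) (hRz0 i)
    show τ₂ + β i t * Rz i ≤ θ i t - sL
    linarith
  · -- hmesh
    intro i t ht
    obtain ⟨-, hall⟩ := hprof t (hτ₀' _ ht).2.2.2.1
    obtain ⟨-, hs, -, hS, hRR⟩ := hall i
    have hβRb : β i t * Rb t ≤ Bβ i * Rb t := mul_le_mul_of_nonneg_right (hβB i t) (hRb0 t)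
    refine ⟨?_, ?_, ?_⟩
    · show Sm ≤ θ i t - sL - β i t * Rb t
      linarith
    · show Rb t ≤ Rr i (θ i t - sL - β i t * Rb t + sL)
      rw [show θ i t - sL - β i t * Rb t + sL = θ i t - β i t * Rb t by ring]
      exact hRR.trans (hRrm i (by linarith))
    · show θ i t - sL + β i t * Rb t ≤ t
      linarith
  · -- hzone
    intro i t ht
    obtain ⟨-, hall⟩ := hprof t (hτ₀' _ ht).2.2.2.1
    obtain ⟨-, hs, -, hS, hRR⟩ := hall i
    have hRzb : Rz i ≤ Rb t := (hτ₀' _ ht).1 i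
    have hθt : θ i t ≤ t + sL := (hτ₀' _ ht).2.1 i
    have hβRb : β i t * Rb t ≤ Bβ i * Rb t := mul_le_mul_of_nonneg_right (hβB i t) (hRb0 t)
    have hβRz : β i t * Rz i ≤ β i t * Rb t := mul_le_mul_of_nonneg_left hRzb (hβ0 i t)
    have hβ0' : 0 ≤ β i t * Rb t := mul_nonneg (hβ0 i t) (hRb0 t)
    have hkey : Rb t ≤ Rr i (θ i t - β i t * Rb t) := hRR.trans (hRrm i (by linarith))
    refine ⟨?_, ?_, ?_⟩
    · show Sm ≤ θ i t - sL - β i t * Rz i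
      linarith
    · show Rz i ≤ Rr i (θ i t - sL - β i t * Rz i + sL)
      rw [show θ i t - sL - β i t * Rz i + sL = θ i t - β i t * Rz i by ring]
      exact hRzb.trans (hkey.trans (hRrm i (by linarith)))
    · show Rz i ≤ Rr i (t + sL)
      exact hRzb.trans (hkey.trans (hRrm i (by linarith)))

end Transfer

end Summit.FinalStateConjecture.FinalStateConjecture.Theorems

end
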